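import Mathlib
import Summits.ValiantsHypothesis.ValiantsHypothesis.Theses.BarrierLever
import Literature.Barriers.ValiantsHypothesis.CT23LowerBoundsFromSuccinctHittingSets
import Literature.Computability.AlgebraicComplexity.LinSubst
import Literature.ModelTheory.FiniteModelTheory.SymmetricCircuitCountingWidthProofs
import Summits.ValiantsHypothesis.ValiantsHypothesis.Theorems.BarrierLeverROABPSliceEquations

/-!
# Crux `BarrierLever.DefinableEquations` (stmt-8745) / `SingleSizeEquations` (stmt-8749) —
# the CT23 DICHOTOMY: either the crux's rung `b` holds, or refuting it separates `poly(n)`-size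
# projection circuits from `poly(N)`-size Boolean sums (CONDITIONAL on `CT23_lemma_4_7`; val-np-p5 g8)

CONDITIONAL RESULT.  Every theorem of §3–§4 takes the hypothesis `CT23_lemma_4_7` — the tree's
NAMED FACT (unproved; Literature/Barriers/ValiantsHypothesis/CT23LowerBoundsFromSuccinctHittingSets)
rendering Chatterjee–Tengse, *Lower bounds from succinct hitting sets* (arXiv:2309.07612v2),
Lemma 4.7: for all large `n, d, s` in the regime `(nds)^c ≤ C(n+d, d)`, a NONZERO multilinear
integer polynomial in the `C(n+d,d)` variables, computed with `≤ (nds)^c` workspace variables by a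
constant-free fan-in-two circuit WITH PROJECTION GATES of size `≤ (nds)^c` (a `VPSPACE⁰`-type
datum), vanishes at the evaluation vector of every `n`-variate polynomial of degree `≤ d` and size
`≤ s`.  Nothing here is progress on `VP ≠ VNP`; the crux stays OPEN (b = 2 = CT23 §1.3 dir. 2).

* §3 `ct23_equation`: the fact in the tree's frame `d = n`, `s = n^b + n` (so that `s` is large;
  the regime hypothesis `n^{c₀(b+4)} ≤ C(2n,n)` holds for `n ≥ 2·4^{c₀(b+4)+2}`,
  `pow_le_centralBinom`): for every `b`, eventually in `n`, CT23's datum `(t, P, Q)` with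
  `t, |Q| ≤ n^c` vanishing on the EVALUATION vectors of `SmallCircuits ℂ n b`.
* §4 **`dichotomy`**: for every `b`, EITHER the inner statement of the crux holds at `b` (some
  level `a`, eventually: a nonzero level-`a` Boolean sum vanishing on `coeff(SmallCircuits ℂ n b)`),
  OR for EVERY level `a`, infinitely often in `n`, the pulled-back equation `D = Vᵀ · P`
  (`V` = the invertible simplex Vandermonde matrix of CT23 Prop. 4.4 moving between coefficient
  and evaluation vectors; §1 `eval_linSubst_transpose`, `linSubst_injective`) is a NONZERO equation
  of `SmallCircuits ℂ n b` which is NOT `boolSum H` for any level-`a` datum `H`.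
  **`singleSizeEquations_or_separation`**: `CT23_lemma_4_7 → SingleSizeEquations ∨ (that separation
  at some rung b)`.  In words: refuting the crux at `b` exhibits, at every level `a` and
  infinitely often, an explicit polynomial — one linear change of coordinates away from a
  `poly(n) = polylog(N)`-size projection-circuit datum — outside the level-`a` Boolean sums at
  scale `N = C(2n,n)`: a `VPSPACE`-type versus `VNP`-type separation, the kernel form of
  `…Status.lean`'s remark "refuting the crux is itself a frontier theorem" (CT23 §5).

What this is NOT: not a verdict; conditional on a named fact whose discharge (CT23's succinct
linear algebra in projection circuits, §2.4/§3.2 of the source) is not in the tree; the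
separation in the second branch is per-`n` and non-uniform, exactly as strong as the data allow.
No definitions, no new named facts; standard axioms.
-/

-- `Summit.ValiantsHypothesis.ValiantsHypothesis.…` repeats a component by the D-0017 layout
-- (single-conjunct summit), which the `dupNamespace` linter flags; the name is mandated.
set_option linter.dupNamespace false

noncomputable section

namespace Summit.ValiantsHypothesis.ValiantsHypothesis.Theorems.BarrierLeverDefinableEquations

open MvPolynomial
open Literature.Computability.AlgebraicComplexity Literature.Barriers.ValiantsHypothesis
open Summit.ValiantsHypothesis.ValiantsHypothesis.Theses.BarrierLever
open scoped BigOperators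

namespace CT23Dichotomy

/-! ## §1 Linear substitutions: evaluation and injectivity (two folklore lemmas) -/

/-- `(Mᵀ · p)(y) = p(M y)`: evaluating the linear substitution by `Mᵀ` at `y` is evaluating `p`
at `M.mulVec y`. [folklore] -/
theorem eval_linSubst_transpose {S : Type*} [Fintype S] (M : Matrix S S ℂ) (y : S → ℂ)
    (p : MvPolynomial S ℂ) :
    eval y (linSubst S ℂ M.transpose p) = eval (M.mulVec y) p := by
  -- adapted from the private `eval_linSubst` of CT23LowerBoundsFromSuccinctHittingSets.lean
  have h : linSubst S ℂ M.transpose p =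
      bind₁ (fun i => ∑ j, M.transpose j i • (X j : MvPolynomial S ℂ)) p := by
    simp [linSubst, aeval_eq_bind₁]
  rw [h]
  change eval₂Hom (RingHom.id ℂ) y (bind₁ _ p) = _
  rw [eval₂Hom_bind₁]
  change eval (fun i => eval y (∑ j, M.transpose j i • (X j : MvPolynomial S ℂ))) p = _
  have hfun : (fun i => eval y (∑ j, M.transpose j i • (X j : MvPolynomial S ℂ))) = M.mulVec y := by
    funext i
    simp [smul_eval, Matrix.mulVec, dotProduct, Matrix.transpose_apply]
  rw [hfun]

/-- A linear substitution by a matrix with unit determinant is injective. [folklore] -/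
theorem linSubst_injective {S : Type*} [Fintype S] [DecidableEq S] (A : Matrix S S ℂ)
    (hA : IsUnit A.det) : Function.Injective (linSubst S ℂ A) := by
  intro x y hxy
  have := congrArg (linSubst S ℂ A⁻¹) hxy
  simp only [← AlgHom.comp_apply, ← linSubst_mul, Matrix.nonsing_inv_mul _ hA, linSubst_one,
    AlgHom.id_apply] at this
  exact this

/-! ## §2 The budget: `n^{c} ≤ C(2n, n)` eventually (`2^n ≤ C(2n,n)` is the tree's
`Literature.ModelTheory.FiniteModelTheory.two_pow_le_choose_two_mul_self`) -/

/-- Polynomial versus exponential: `n^B ≤ C(2n, n)` for `n ≥ 2 · 4^{B+2}`. [folklore] -/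
theorem pow_le_centralBinom {B n : ℕ} (hn : 2 * 4 ^ (B + 2) ≤ n) : n ^ B ≤ Nat.choose (2 * n) n := by
  have h1 := BarrierLever.ROABPSlice.pow_lt_two_pow_half hn
  have h2 : 2 ^ (n / 2) ≤ 2 ^ n := Nat.pow_le_pow_right (by norm_num) (Nat.div_le_self n 2)
  exact (h1.le.trans h2).trans
    (Literature.ModelTheory.FiniteModelTheory.two_pow_le_choose_two_mul_self n)

/-! ## §3 CT23's `VPSPACE⁰`-explicit equation in the tree's frame `d = n`, `s = n^b` -/

/-- **CT23 Lemma 4.7 at `(n, b)`** (conditional on the named fact `CT23_lemma_4_7`): for every `b`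
there are `c, n₁` such that for all `n ≥ n₁` some NONZERO multilinear INTEGER polynomial `P` in the
`C(2n,n)` variables, computed (with `t ≤ n^c` workspace variables) by a constant-free fan-in-two
PROJECTION circuit of size `≤ n^c`, vanishes at the EVALUATION vector of every
`f ∈ SmallCircuits ℂ n b`.  (Instance `d = n`, `s = n^b + n` of the fact; the regime hypothesis
`(n·n·s)^{c₀} ≤ C(2n,n)` holds for `n ≥ 2·4^{c₀(b+4)+2}`; `c = c₀ (b+4)`.) [cite: ChatterjeeTengse2023, Lemma 4.7] -/
theorem ct23_equation (hCT : CT23_lemma_4_7) (b : ℕ) :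
    ∃ c n₁ : ℕ, ∀ n ≥ n₁, ∃ (t : ℕ) (P : MvPolynomial ↥(degLEMonomials n) ℤ)
      (Q : ProjCircuit ℤ (↥(degLEMonomials n) ⊕ Fin t)),
      P ≠ 0 ∧ (∀ v, P.degreeOf v ≤ 1) ∧ Q.IsFanInTwo ∧ Q.HasSignConstants ∧
        Q.Computes (rename Sum.inl P) ∧ t ≤ n ^ c ∧ Q.size ≤ n ^ c ∧
        ∀ f ∈ SmallCircuits ℂ n b,
          eval (evalVector ℂ n f) (MvPolynomial.map (Int.castRingHom ℂ) P) = 0 := by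
  obtain ⟨c₀, N₀, h⟩ := hCT ℂ
  refine ⟨c₀ * (b + 4), max N₀ (2 * 4 ^ (c₀ * (b + 4) + 2)), fun n hn => ?_⟩
  have hN₀ : N₀ ≤ n := le_trans (le_max_left _ _) hn
  have hbig : 2 * 4 ^ (c₀ * (b + 4) + 2) ≤ n := le_trans (le_max_right _ _) hn
  have hn2 : 2 ≤ n :=
    le_trans (by nlinarith [Nat.one_le_pow (c₀ * (b + 4) + 2) 4 (by norm_num)]) hbig
  -- the size parameter `s = n^b + n ≥ N₀`
  have hs : N₀ ≤ n ^ b + n := hN₀.trans (Nat.le_add_left _ _)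
  have hpow : (n * n * (n ^ b + n)) ^ c₀ ≤ n ^ (c₀ * (b + 4)) := by
    have h1 : n ^ b + n ≤ n ^ (b + 2) := by
      have hb1 : n ^ b ≤ n ^ (b + 1) := Nat.pow_le_pow_right (by omega) (by omega)
      have hn1 : n ≤ n ^ (b + 1) := by
        calc n = n ^ 1 := (pow_one n).symm
          _ ≤ n ^ (b + 1) := Nat.pow_le_pow_right (by omega) (by omega)
      calc n ^ b + n ≤ 2 * n ^ (b + 1) := by omega
        _ ≤ n * n ^ (b + 1) := Nat.mul_le_mul_right _ hn2
        _ = n ^ (b + 2) := by ring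
    calc (n * n * (n ^ b + n)) ^ c₀ ≤ (n * n * n ^ (b + 2)) ^ c₀ :=
          Nat.pow_le_pow_left (Nat.mul_le_mul_left _ h1) _
      _ = (n ^ (b + 4)) ^ c₀ := by ring
      _ = n ^ (c₀ * (b + 4)) := by rw [← pow_mul, mul_comm]
  have hreg : (n * n * (n ^ b + n)) ^ c₀ ≤ (n + n).choose n := by
    rw [← two_mul]; exact hpow.trans (pow_le_centralBinom hbig)
  obtain ⟨t, P, Q, hP0, hml, hfi, hsc, hcomp, ht, hsize, hvan⟩ := h n n (n ^ b + n) hN₀ hN₀ hs hreg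
  refine ⟨t, P, Q, hP0, hml, hfi, hsc, hcomp, ht.trans hpow, hsize.trans hpow, fun f hf => ?_⟩
  exact hvan f hf.1 (hf.2.trans (Nat.le_add_right _ _))

/-! ## §4 The dichotomy -/

/-- **CT23 DICHOTOMY for the crux, rung by rung** (conditional on `CT23_lemma_4_7`).  For every
size exponent `b`, EITHER the inner statement of `SingleSizeEquations` / `DefinableEquations`
holds at `b` (some level `a`, eventually in `n`: a nonzero level-`a` Boolean sum vanishing on
`coeff(SmallCircuits ℂ n b)`), OR for every level `a`, for infinitely many `n`, the explicit
equation `D = P ∘ Vᵀ` — `P` CT23's multilinear integer polynomial of constant-free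
projection-circuit size `≤ n^c` (with workspace), `V` the invertible simplex-Vandermonde change
of coordinates from coefficient to evaluation vectors (CT23 Prop. 4.4) — is a nonzero equation
of `SmallCircuits ℂ n b` that is NOT the Boolean sum of any level-`a` datum: refuting the crux at
`b` separates `poly(n)`-size projection circuits (composed with one linear map) from `N^a`-size
Boolean sums at scale `N = C(2n,n)`, infinitely often, at every level `a` — the tree's form of
"refuting the crux is itself a frontier theorem" (Chatterjee–Tengse 2023 §5).
[cite: ChatterjeeTengse2023, Lemma 4.7 and Prop. 4.6] -/
theorem dichotomy (hCT : CT23_lemma_4_7) (b : ℕ) :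
    (∃ a n₀ : ℕ, ∀ n ≥ n₀, ∃ q : ℕ, q ≤ Nat.choose (2 * n) n ^ a ∧
      ∃ H : MvPolynomial (↥(degLEMonomials n) ⊕ Fin q) ℂ,
        complexity H ≤ Nat.choose (2 * n) n ^ a ∧ H.totalDegree ≤ Nat.choose (2 * n) n ^ a ∧
        boolSum H ≠ 0 ∧
        ∀ f ∈ SmallCircuits ℂ n b, eval (coeffVector (degLEMonomials n) f) (boolSum H) = 0) ∨
    (∃ c : ℕ, ∀ a n₀ : ℕ, ∃ n, n₀ ≤ n ∧
      ∃ (t : ℕ) (P : MvPolynomial ↥(degLEMonomials n) ℤ)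
        (Q : ProjCircuit ℤ (↥(degLEMonomials n) ⊕ Fin t)) (D : MvPolynomial ↥(degLEMonomials n) ℂ),
        P ≠ 0 ∧ (∀ v, P.degreeOf v ≤ 1) ∧ Q.IsFanInTwo ∧ Q.HasSignConstants ∧
        Q.Computes (rename Sum.inl P) ∧ t ≤ n ^ c ∧ Q.size ≤ n ^ c ∧
        (∃ A : Matrix ↥(degLEMonomials n) ↥(degLEMonomials n) ℂ, IsUnit A.det ∧
          D = linSubst _ ℂ A (MvPolynomial.map (Int.castRingHom ℂ) P)) ∧
        D ≠ 0 ∧ (∀ f ∈ SmallCircuits ℂ n b, eval (coeffVector (degLEMonomials n) f) D = 0) ∧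
        ∀ q : ℕ, q ≤ Nat.choose (2 * n) n ^ a →
          ∀ H : MvPolynomial (↥(degLEMonomials n) ⊕ Fin q) ℂ,
            complexity H ≤ Nat.choose (2 * n) n ^ a → H.totalDegree ≤ Nat.choose (2 * n) n ^ a →
            boolSum H ≠ D) := by
  by_cases h1 : ∃ a n₀ : ℕ, ∀ n ≥ n₀, ∃ q : ℕ, q ≤ Nat.choose (2 * n) n ^ a ∧
      ∃ H : MvPolynomial (↥(degLEMonomials n) ⊕ Fin q) ℂ,
        complexity H ≤ Nat.choose (2 * n) n ^ a ∧ H.totalDegree ≤ Nat.choose (2 * n) n ^ a ∧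
        boolSum H ≠ 0 ∧
        ∀ f ∈ SmallCircuits ℂ n b, eval (coeffVector (degLEMonomials n) f) (boolSum H) = 0
  · exact Or.inl h1
  right
  push Not at h1
  obtain ⟨c, n₁, hP⟩ := ct23_equation hCT b
  refine ⟨c, fun a n₀ => ?_⟩
  obtain ⟨n, hn, hno⟩ := h1 a (max n₀ n₁)
  obtain ⟨t, P, Q, hP0, hml, hfi, hsc, hcomp, ht, hsize, hvan⟩ := hP n (le_trans (le_max_right _ _) hn)
  -- the change of coordinates from coefficient to evaluation vectors
  letI : Fintype ↥(monomialsDegLE n n) := degLEMonomials.instFintype n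
  set V : Matrix ↥(degLEMonomials n) ↥(degLEMonomials n) ℂ := simplexVandermonde ℂ n n with hV
  have hVdet : IsUnit V.transpose.det := by
    rw [Matrix.det_transpose]; exact isUnit_det_simplexVandermonde ℂ n n
  set D := linSubst _ ℂ V.transpose (MvPolynomial.map (Int.castRingHom ℂ) P) with hD
  have hD0 : D ≠ 0 := by
    intro h0
    have hmap : MvPolynomial.map (Int.castRingHom ℂ) P ≠ 0 := by
      intro hm
      exact hP0 (MvPolynomial.map_injective _ Int.cast_injective (by rw [hm, map_zero]))
    exact hmap (linSubst_injective V.transpose hVdet (by rw [← hD, h0, map_zero]))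
  have hDvan : ∀ f ∈ SmallCircuits ℂ n b, eval (coeffVector (degLEMonomials n) f) D = 0 := by
    intro f hf
    have hev : evalVector ℂ n f =
        (simplexVandermonde ℂ n n).mulVec (coeffVector (degLEMonomials n) f) :=
      evalVector_eq_mulVec ℂ hf.1
    have h0 := hvan f hf
    rw [hev] at h0
    rw [hD, eval_linSubst_transpose, hV]
    convert h0 using 2; rfl
  refine ⟨n, le_trans (le_max_left _ _) hn, t, P, Q, D, hP0, hml, hfi, hsc, hcomp, ht, hsize,
    ⟨V.transpose, hVdet, hD⟩, hD0, hDvan, fun q hq H hc hd hHD => ?_⟩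
  obtain ⟨f, hf, hne⟩ := hno q hq H hc hd (by rw [hHD]; exact hD0)
  exact hne (by rw [hHD]; exact hDvan f hf)

/-- **The same with the route's decl.**  `CT23_lemma_4_7 → SingleSizeEquations ∨ (separation at
some rung)`: if the crux's single-size form fails then at some `b`, for every level `a` and
infinitely often in `n`, CT23's equation (pulled back to coefficient space) is a nonzero equation
of `SmallCircuits ℂ n b` outside the level-`a` Boolean sums. [cite: ChatterjeeTengse2023, Lemma 4.7] -/
theorem singleSizeEquations_or_separation (hCT : CT23_lemma_4_7) :
    SingleSizeEquations ∨
    (∃ b c : ℕ, ∀ a n₀ : ℕ, ∃ n, n₀ ≤ n ∧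
      ∃ (t : ℕ) (P : MvPolynomial ↥(degLEMonomials n) ℤ)
        (Q : ProjCircuit ℤ (↥(degLEMonomials n) ⊕ Fin t)) (D : MvPolynomial ↥(degLEMonomials n) ℂ),
        P ≠ 0 ∧ (∀ v, P.degreeOf v ≤ 1) ∧ Q.IsFanInTwo ∧ Q.HasSignConstants ∧
        Q.Computes (rename Sum.inl P) ∧ t ≤ n ^ c ∧ Q.size ≤ n ^ c ∧
        (∃ A : Matrix ↥(degLEMonomials n) ↥(degLEMonomials n) ℂ, IsUnit A.det ∧
          D = linSubst _ ℂ A (MvPolynomial.map (Int.castRingHom ℂ) P)) ∧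
        D ≠ 0 ∧ (∀ f ∈ SmallCircuits ℂ n b, eval (coeffVector (degLEMonomials n) f) D = 0) ∧
        ∀ q : ℕ, q ≤ Nat.choose (2 * n) n ^ a →
          ∀ H : MvPolynomial (↥(degLEMonomials n) ⊕ Fin q) ℂ,
            complexity H ≤ Nat.choose (2 * n) n ^ a → H.totalDegree ≤ Nat.choose (2 * n) n ^ a →
            boolSum H ≠ D) := by
  by_cases hS : SingleSizeEquations
  · exact Or.inl hS
  right
  unfold SingleSizeEquations at hS
  push Not at hS
  obtain ⟨b, hb⟩ := hS
  rcases dichotomy hCT b with h | ⟨c, hc⟩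
  · -- the first branch contradicts `hb`
    obtain ⟨a, n₀, h⟩ := h
    obtain ⟨n, hn, hno⟩ := hb a n₀
    obtain ⟨q, hq, H, hcH, hdH, hne, hvan⟩ := h n hn
    obtain ⟨f, hf, hnef⟩ := hno q hq H hcH hdH hne
    exact absurd (hvan f hf) hnef
  · exact ⟨b, c, hc⟩

end CT23Dichotomy

end Summit.ValiantsHypothesis.ValiantsHypothesis.Theorems.BarrierLeverDefinableEquations
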